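import Summits.QuantumFields.YangMills.Theorems.BalabanUVNodesSpineReadingOfRecord13CoPHKRatioDominationBankedChronoOfRecordCeiling
import Summits.QuantumFields.YangMills.Theorems.BalabanUVNodesN20FibreDomComposition

/-!
# N20 (NE7b) ON THE TOWER-FREE ROAD, THE FACE OF RECORD WITH ITEM (a) IN PRINT'S PER-REGION FORM: margins `κ₁, E₀` and a coupling ceiling `γ₀ > 0` from the constants, then —
# for every carrier tuple whose histories of record stay in `]0, γ₀]` and obey (2.7) — ONE-COMPONENT relative letters along a removal schedule (each old component removed on its
# OWN fibre at the price of ITS OWN raw factor `e^{−credits}·e^{+lifeCost}`), the data and labels (b), the multiplicities (ID) and the cut give `RelWeightBound`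

Cell `pub-ymgap`, YM-PLAN Track A (HUMAN RULING D-0062); seat `pub-ymgap-dag-n20-d` (R134 (a) N20 NE7b s3), gen 43 — director-ym №374 line (E), road [e] TOWER-FREE of record (№377).
`--kind proof --supports stmt-QuantumFields-27366 --as helper` (K3⁸); COUNT-NEUTRAL helper ∕ NOT a discharge; THEOREMS ONLY (0 `def`).  [III] = [Balaban1988Convergent]; [LF-II] = [Balaban1989LargeFieldII];
[IV] = [Balaban1989LargeFieldI].  Companions BY NAME: `…BankedChronoOfRecordCeiling.exists_margins_smallCoupling_relWeightBound_chronoGenealogies_ofRecord` (gen 42, p782644),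
`…N20FibreDomComposition.fibreDom_chain` (gen 43: letters on sub-fibres enlarge by Fubini and compose along a chain).

WHY.  ✓p782644 displays item (a) as ONE letter per bad history on the WHOLE removal fibre with a free factor `z s` plus the clause `z s ≤ Π_{Y ∈ φ σ s} e^{−credits(G Y)}·e^{+lifeCost(G Y)}`.
Print's bound is PER REGION ([LF-II] p. 383 last two lines – p. 384 l. 1 «Notice that the above inequality holds for all large field regions, not only for the regions satisfying the
conditions (i), (ii)»; p. 387 l. 23–29 «the inequality (1.79) holds for the T-operation connected with an arbitrary large field region … hence also an improved bound (1.89), with the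
additional term −κ₁d_k(X) in the exponential»), and its product over separated components is iterated conditional integration over disjoint bond sets — Fubini on the
finite Haar product (`fibreDom_chain`).  So the face is restated with (a) := a removal SCHEDULE per bad history (`n s` links `s = u₀ → u₁ → … → u_{n s}`, the `i`-th link removing the
old component `comp s i` on its fibre `fibY (comp s i) ⊆ fib s`) and ONE-COMPONENT LETTERS «`∫⌈_{fibY Y}(χ·dr)(u_i) ≤ e^{−credits(G Y)}·e^{+lifeCost(G Y)} · ∫⌈_{fibY Y}(χ·dr)(u_{i+1})`
at every configuration, `Y = comp s i`»: the letter names ONE component, ITS fibre and ITS raw factor — the shape of print's sentence.  The free factor `z` and the factor clause are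
GONE (`z s := Π_i (raw factor of comp s i)`, the clause an equality for an injective schedule); the removal map is the schedule's end `u_{n s}`, the fibre family `φ σ s` the schedule's
image.  ONE binder is NEW and displayed: the pieces `χ·dr` are BOUNDED ABOVE per history (continuous functions on a compact group; def-T ∕ K0c shape, next to measurability).

WHAT IS PROVED (kernel; zero `sorry`).  ★★★ `exists_margins_smallCoupling_relWeightBound_chronoGenealogies_ofRecord_perRegion` (✓p782644 ∘ `fibreDom_chain` per bad history, the
schedule's image as the fibre family, `Finset.prod_image` for the factor clause).

WHAT STAYS DISPLAYED (NOT PRINTED as theorems of [LF-II] for `d = 4`, NOT proved here): (a′) the ONE-COMPONENT relative letters along the schedules — [LF-II] (1.79)∕(1.89)-improved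
KIND read RELATIVELY on [IV] (0.3)'s fibre (junction NC-NE7b-α UNRULED; `pub-balaban`'s R3′) — and the schedules themselves (which old components, in which order, on which fibres,
ending in the good class: DEFINER, with (b)); (b) slot filing into the boxes, genealogy LABELS; (ID) fibre multiplicities `≤ M^{partnerAges}` and caps; (F) slopes, the histories of
record in `]0, γ₀]` and (2.7) at `p₀` up to the level (B14's currency); the cut `j⋆`, `c`; measurability ∕ integrability ∕ boundedness of the pieces (def-T ∕ K0c shapes);
`hP : θ.Provisos₁₃CoPH` (K0⁷).

HONEST FRAMING.  [bookkeeping + Fubini]: one composition; no estimate.  NOTHING of Bałaban's is asserted; NO weight of Bałaban's is bounded; NE7 ∕ NE7b ∕ NE7c NOT PRINTED for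
`d = 4` ∕ NOT proved; no `Provisos₁₃CoPH` inhabitant claimed (K0⁷ OPEN); K3⁸ untouched; N20 NOT discharged; counts UNMOVED (typed 28∕28 · discharged 8∕27); one finite four-torus
programme at fixed `ε` — NOT ℝ⁴, NOT OS, NOT a mass gap, NOT the Clay problem.  No `def`, no `instance`, no `notation`, no `sorry`; no decl below carries a cite tag.
-/

noncomputable section

open MeasureTheory
open scoped BigOperators
open Finset

namespace YMDAG.UVSplit

open Literature.MathematicalPhysics.QuantumFieldTheory.Balaban1983to89
open Literature.MathematicalPhysics.QuantumFieldTheory.Balaban1983to89.T4Continuum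
open Literature.MathematicalPhysics.QuantumFieldTheory.Balaban1983to89.Node00
open Literature.MathematicalPhysics.QuantumFieldTheory.Balaban1983to89.B15.BasicStep (fibreIntegral)
open T4WeightBudget (RelWeightBound)
open T4PersistenceDictionary (Gen PEv dictW)
open T4BankedInduction (Banking credits lifeCost)
open T4PartnerMultiplicity (partnerAges)
open T4BranchingRecordsGas (relabel shape)
open T4PrintedShapeBanking (Consistent)
open T4CanonicalMenus (Chrono fuel canonFam birthMass birthMass_nonneg)

variable {F : T4Family} {N : ℕ} [NeZero N]

/-! ## §1 The face with item (a) := removal schedules + one-component letters -/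

section PerRegion

open scoped Classical in
/-- ★★★ **THE N20 FACE OF RECORD WITH ITEM (a) IN PRINT'S PER-REGION FORM** (✓`…_ofRecord` ∘ `fibreDom_chain`): for print's valid constants `C₀`, `β₀ ≥ 0`, a window exponent `r`
with `r(q′+1) < p₀`, ANY `M ≥ 0` and `η̄₊ > 0` there are margins `κ₁, E₀ ≥ 0` with `L^4·e^{η̄₊−κ₁} < 1` and a coupling ceiling `γ₀ > 0` — from `(C₀, L, r, β₀, M, η̄₊)`, BEFORE the rank
and the carriers — such that for every rank, carrier tuple `(θ, hP, K₀, g₀, os, kr, bd)`, cut, slopes, whenever the histories of record stay in `]0, γ₀]` and obey (2.7) up to their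
level, the caps, the displayed measurability ∕ integrability ∕ BOUNDEDNESS of the pieces and, per `(K, t)`, EACH RUN's removal SCHEDULES with ONE-COMPONENT LETTERS — link `i` of the
bad history `s` removes the old component `Y = comp s i` on its own fibre `fibY Y ⊆ fib s` at the price of its own raw factor: `∫⌈_{fibY Y}(χ·dr)(u_i) ≤ e^{−credits(G Y)}·e^{+lifeCost(G Y)}·
∫⌈_{fibY Y}(χ·dr)(u_{i+1})` at every configuration ([LF-II] p. 387 l. 23–29: (1.79) «for the T-operation connected with an arbitrary large field region» with the improved (1.89),
read on [IV] (0.3)'s fibre) —, good images of the schedules' ends, scheduled components filed in `Old` (injective, non-empty schedules; injective fibre families), data and labels (b), multiplicities (ID)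
give `RelWeightBound 1 … (K ↦ 1 − exp(−S_K))`, `S_K = birthMass C₀·e^{−κ₁}·ℓ^4·ρ^{K − j⋆(K) + 1}∕(1 − ρ)`, `ρ = L^4·e^{η̄₊−κ₁}`.  No free factor `z`, no factor clause: the product
of the scheduled components' raw factors IS the factor (`fibreDom_chain`, `Finset.prod_image`). [bookkeeping] -/
theorem exists_margins_smallCoupling_relWeightBound_chronoGenealogies_ofRecord_perRegion {X : Type*} (C₀ : T4PrintedShapeBanking.Consts) (hCv : C₀.Valid) (ha : 0 < C₀.a)
    (hA : 0 < C₀.A₀) (hμ₀ : 0 < C₀.μ) {r : ℕ} {β₀ : ℝ} (hβ : 0 ≤ β₀) (hrq : r * (C₀.q' + 1) < C₀.p₀) {M ηplus : ℝ} (hM : 0 ≤ M) (hη : 0 < ηplus) :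
    ∃ κ₁ E₀ γ₀ : ℝ, 0 ≤ κ₁ ∧ 0 ≤ E₀ ∧ 0 < γ₀ ∧ (F.L : ℝ) ^ 4 * Real.exp (ηplus - κ₁) < 1 ∧
      ∀ {N : ℕ} [NeZero N] (θ : Stage13HParams F N) (hP : θ.Provisos₁₃CoPH F N) (K₀ : ℕ) (g₀ : ℕ → ℝ) (os : List (ULoop F))
      (kr : ℕ → (Σ K, SiteSeqKey F (K₀ + K)) → (Σ K, SiteSeqKey F (K₀ + K))) (bd : ℕ → (Σ K, SiteSeqKey F (K₀ + K)) → Prop) (c : ℝ), 0 < c →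
      ∀ (jstar : ℕ → ℕ), (∀ K, jstar K ≤ K) → (∀ K : ℕ, c * K ≤ ((K - jstar K : ℕ) : ℝ)) →
      ∀ (β' : ℕ → ℝ), (∀ K, 0 ≤ β' K) → 1 + β₀ ≤ (F.L : ℝ) →
        (∀ K, Step.InInterval γ₀ (K₀ + K) (histA₁₃ θ K₀ g₀ K)) → (∀ K, B14.FlowIneq27 (histA₁₃ θ K₀ g₀ K) (β' K) β₀ C₀.p₀ (K₀ + K)) →
      ∀ (Dcap Ncap : ℕ → ℕ),
      (∀ K t s, Measurable fun V => chiSeqOfRecord F N θ.ν θ.τ9.M (histA₁₃ θ K₀ g₀ K) (K₀ + K) (K₀ + K) s V *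
        dressedSlotsOfDatum₉ F N θ.toStage9Params (datumOfRecord₁₃CoPH F N θ hP) g₀ os t (runA₁₃ F K₀ g₀ K) (histA₁₃ θ K₀ g₀ K) (K₀ + K) s V) →
      (∀ K t s, Integrable (fun V => chiSeqOfRecord F N θ.ν θ.τ9.M (histA₁₃ θ K₀ g₀ K) (K₀ + K) (K₀ + K) s V *
        dressedSlotsOfDatum₉ F N θ.toStage9Params (datumOfRecord₁₃CoPH F N θ hP) g₀ os t (runA₁₃ F K₀ g₀ K) (histA₁₃ θ K₀ g₀ K) (K₀ + K) s V)
        (fieldMeasure (F.P (K₀ + K)) (K₀ + K) (SU N))) →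
      (∀ K t s', Measurable fun V => chiSeqOfRecord F N θ.ν θ.τ9.M (histB₁₃ θ K₀ g₀ K) (K₀ + K + 1) (K₀ + K + 1) s' V *
        dressedSlotsOfDatum₉ F N θ.toStage9Params (datumOfRecord₁₃CoPH F N θ hP) g₀ os t (runB₁₃ F K₀ g₀ K) (histB₁₃ θ K₀ g₀ K) (K₀ + K + 1) s' V) →
      (∀ K t s', Integrable (fun V => chiSeqOfRecord F N θ.ν θ.τ9.M (histB₁₃ θ K₀ g₀ K) (K₀ + K + 1) (K₀ + K + 1) s' V *
        dressedSlotsOfDatum₉ F N θ.toStage9Params (datumOfRecord₁₃CoPH F N θ hP) g₀ os t (runB₁₃ F K₀ g₀ K) (histB₁₃ θ K₀ g₀ K) (K₀ + K + 1) s' V)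
        (fieldMeasure (F.P (K₀ + K + 1)) (K₀ + K + 1) (SU N))) →
      (∀ K t s, ∃ C : ℝ, ∀ V, chiSeqOfRecord F N θ.ν θ.τ9.M (histA₁₃ θ K₀ g₀ K) (K₀ + K) (K₀ + K) s V *
        dressedSlotsOfDatum₉ F N θ.toStage9Params (datumOfRecord₁₃CoPH F N θ hP) g₀ os t (runA₁₃ F K₀ g₀ K) (histA₁₃ θ K₀ g₀ K) (K₀ + K) s V ≤ C) →
      (∀ K t s', ∃ C : ℝ, ∀ V, chiSeqOfRecord F N θ.ν θ.τ9.M (histB₁₃ θ K₀ g₀ K) (K₀ + K + 1) (K₀ + K + 1) s' V *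
        dressedSlotsOfDatum₉ F N θ.toStage9Params (datumOfRecord₁₃CoPH F N θ hP) g₀ os t (runB₁₃ F K₀ g₀ K) (histB₁₃ θ K₀ g₀ K) (K₀ + K + 1) s' V ≤ C) →
      (∀ (K : ℕ) (t : ℝ), |t| ≤ 1 →
        ∃ (n : SeqOfRecord F θ.ν θ.τ9.M (histA₁₃ θ K₀ g₀ K) (K₀ + K) (K₀ + K) → ℕ)
          (chain : (s : SeqOfRecord F θ.ν θ.τ9.M (histA₁₃ θ K₀ g₀ K) (K₀ + K) (K₀ + K)) → Fin (n s + 1) → SeqOfRecord F θ.ν θ.τ9.M (histA₁₃ θ K₀ g₀ K) (K₀ + K) (K₀ + K))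
          (comp : (s : SeqOfRecord F θ.ν θ.τ9.M (histA₁₃ θ K₀ g₀ K) (K₀ + K) (K₀ + K)) → Fin (n s) → X)
          (fib : SeqOfRecord F θ.ν θ.τ9.M (histA₁₃ θ K₀ g₀ K) (K₀ + K) (K₀ + K) → Finset (PBond (F.P (K₀ + K)) (K₀ + K))) (fibY : X → Finset (PBond (F.P (K₀ + K)) (K₀ + K)))
          (Old : SeqOfRecord F θ.ν θ.τ9.M (histA₁₃ θ K₀ g₀ K) (K₀ + K) (K₀ + K) → Finset X)
          (slot : X → (Σ _ : ℕ, (Fin 4 → ℕ))) (G : X → Gen PEv),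
          (∀ s, kr K (keyA₁₃ θ K₀ g₀ K s) ∈ badClassK₁₃ θ K₀ g₀ kr bd K t → chain s 0 = s) ∧
          (∀ s, kr K (keyA₁₃ θ K₀ g₀ K s) ∈ badClassK₁₃ θ K₀ g₀ kr bd K t → ∀ i, fibY (comp s i) ⊆ fib s) ∧
          (∀ s, kr K (keyA₁₃ θ K₀ g₀ K s) ∈ badClassK₁₃ θ K₀ g₀ kr bd K t → ∀ (i : Fin (n s)) (V : _),
            fibreIntegral (fibY (comp s i)) (fun V => chiSeqOfRecord F N θ.ν θ.τ9.M (histA₁₃ θ K₀ g₀ K) (K₀ + K) (K₀ + K) (chain s i.castSucc) V *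
                dressedSlotsOfDatum₉ F N θ.toStage9Params (datumOfRecord₁₃CoPH F N θ hP) g₀ os t (runA₁₃ F K₀ g₀ K) (histA₁₃ θ K₀ g₀ K) (K₀ + K) (chain s i.castSucc) V) V ≤
              (Real.exp (-credits (T4PrintedShapeBanking.credit C₀ (fun j => histA₁₃ θ K₀ g₀ K (min j (K₀ + K)))) (G (comp s i))) *
              Real.exp (lifeCost (dictW (fun s => RkOfRecord F.L r (histA₁₃ θ K₀ g₀ K s)) C₀.n₁) (T4PrintedShapeBanking.cost C₀ (K₀ + K) (fun s => RkOfRecord F.L r (histA₁₃ θ K₀ g₀ K s))) (G (comp s i)))) *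
              fibreIntegral (fibY (comp s i)) (fun V => chiSeqOfRecord F N θ.ν θ.τ9.M (histA₁₃ θ K₀ g₀ K) (K₀ + K) (K₀ + K) (chain s i.succ) V *
                dressedSlotsOfDatum₉ F N θ.toStage9Params (datumOfRecord₁₃CoPH F N θ hP) g₀ os t (runA₁₃ F K₀ g₀ K) (histA₁₃ θ K₀ g₀ K) (K₀ + K) (chain s i.succ) V) V) ∧
          (∀ s, kr K (keyA₁₃ θ K₀ g₀ K s) ∈ badClassK₁₃ θ K₀ g₀ kr bd K t → kr K (keyA₁₃ θ K₀ g₀ K (chain s (Fin.last (n s)))) ∉ badClassK₁₃ θ K₀ g₀ kr bd K t) ∧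
          (∀ σ s, kr K (keyA₁₃ θ K₀ g₀ K s) ∈ badClassK₁₃ θ K₀ g₀ kr bd K t → chain s (Fin.last (n s)) = σ →
            (∀ i, comp s i ∈ Old σ) ∧ 0 < n s ∧ Function.Injective (comp s)) ∧
          (∀ σ, Set.InjOn (fun s => (Finset.univ : Finset (Fin (n s))).image (comp s)) {s | kr K (keyA₁₃ θ K₀ g₀ K s) ∈ badClassK₁₃ θ K₀ g₀ kr bd K t ∧ chain s (Fin.last (n s)) = σ}) ∧
          (∀ σ, ∀ Y ∈ Old σ, (slot Y).1 < K₀ + jstar K) ∧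
          (∀ σ, ∀ Y ∈ Old σ, (slot Y).2 ∈ Fintype.piFinset fun _ : Fin 4 => Finset.range (2 * F.L ^ F.m * F.L ^ ((K₀ + K) - (slot Y).1))) ∧
          (∀ σ, ∀ Y ∈ Old σ, Consistent C₀ (K₀ + K) (fun s => RkOfRecord F.L r (histA₁₃ θ K₀ g₀ K s)) (G Y)) ∧
          (∀ σ, ∀ Y ∈ Old σ, (G Y).WF (dictW (fun s => RkOfRecord F.L r (histA₁₃ θ K₀ g₀ K s)) C₀.n₁)) ∧
          (∀ σ, ∀ Y ∈ Old σ, K₀ + K < (G Y).reach (dictW (fun s => RkOfRecord F.L r (histA₁₃ θ K₀ g₀ K s)) C₀.n₁)) ∧ (∀ σ, ∀ Y ∈ Old σ, Chrono PEv.step (G Y)) ∧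
          (∀ σ, ∀ Y ∈ Old σ, ∀ e ∈ (G Y).events, e.kind = 0 → e.fat < Dcap (K₀ + K)) ∧ (∀ σ, ∀ Y ∈ Old σ, fuel (G Y) ≤ Ncap (K₀ + K)) ∧
          (∀ σ, ∀ Y ∈ Old σ, (G Y).rootStep = (slot Y).1) ∧
          (∀ σ, ∀ j < K₀ + jstar K, ∀ zc ∈ (Fintype.piFinset fun _ : Fin 4 => Finset.range (2 * F.L ^ F.m * F.L ^ ((K₀ + K) - j))),
            ∀ G₀ ∈ canonFam Dcap Ncap (K₀ + K) j,
            ((((Old σ).filter fun Y => slot Y = ⟨j, zc⟩ ∧ relabel shape (G Y) = G₀).card : ℕ) : ℝ) ≤ M ^ partnerAges PEv.step G₀)) →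
      (∀ (K : ℕ) (t : ℝ), |t| ≤ 1 →
        ∃ (n : SeqOfRecord F θ.ν θ.τ9.M (histB₁₃ θ K₀ g₀ K) (K₀ + K + 1) (K₀ + K + 1) → ℕ)
          (chain : (s : SeqOfRecord F θ.ν θ.τ9.M (histB₁₃ θ K₀ g₀ K) (K₀ + K + 1) (K₀ + K + 1)) → Fin (n s + 1) → SeqOfRecord F θ.ν θ.τ9.M (histB₁₃ θ K₀ g₀ K) (K₀ + K + 1) (K₀ + K + 1))
          (comp : (s : SeqOfRecord F θ.ν θ.τ9.M (histB₁₃ θ K₀ g₀ K) (K₀ + K + 1) (K₀ + K + 1)) → Fin (n s) → X)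
          (fib : SeqOfRecord F θ.ν θ.τ9.M (histB₁₃ θ K₀ g₀ K) (K₀ + K + 1) (K₀ + K + 1) → Finset (PBond (F.P (K₀ + K + 1)) (K₀ + K + 1))) (fibY : X → Finset (PBond (F.P (K₀ + K + 1)) (K₀ + K + 1)))
          (Old : SeqOfRecord F θ.ν θ.τ9.M (histB₁₃ θ K₀ g₀ K) (K₀ + K + 1) (K₀ + K + 1) → Finset X)
          (slot : X → (Σ _ : ℕ, (Fin 4 → ℕ))) (G : X → Gen PEv),
          (∀ s', kr K (keyB₁₃ θ K₀ g₀ K s') ∈ badClassK₁₃ θ K₀ g₀ kr bd K t → chain s' 0 = s') ∧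
          (∀ s', kr K (keyB₁₃ θ K₀ g₀ K s') ∈ badClassK₁₃ θ K₀ g₀ kr bd K t → ∀ i, fibY (comp s' i) ⊆ fib s') ∧
          (∀ s', kr K (keyB₁₃ θ K₀ g₀ K s') ∈ badClassK₁₃ θ K₀ g₀ kr bd K t → ∀ (i : Fin (n s')) (V : _),
            fibreIntegral (fibY (comp s' i)) (fun V => chiSeqOfRecord F N θ.ν θ.τ9.M (histB₁₃ θ K₀ g₀ K) (K₀ + K + 1) (K₀ + K + 1) (chain s' i.castSucc) V *
                dressedSlotsOfDatum₉ F N θ.toStage9Params (datumOfRecord₁₃CoPH F N θ hP) g₀ os t (runB₁₃ F K₀ g₀ K) (histB₁₃ θ K₀ g₀ K) (K₀ + K + 1) (chain s' i.castSucc) V) V ≤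
              (Real.exp (-credits (T4PrintedShapeBanking.credit C₀ (fun j => histB₁₃ θ K₀ g₀ K (min j (K₀ + K + 1)))) (G (comp s' i))) *
              Real.exp (lifeCost (dictW (fun s => RkOfRecord F.L r (histB₁₃ θ K₀ g₀ K s)) C₀.n₁) (T4PrintedShapeBanking.cost C₀ (K₀ + K + 1) (fun s => RkOfRecord F.L r (histB₁₃ θ K₀ g₀ K s))) (G (comp s' i)))) *
              fibreIntegral (fibY (comp s' i)) (fun V => chiSeqOfRecord F N θ.ν θ.τ9.M (histB₁₃ θ K₀ g₀ K) (K₀ + K + 1) (K₀ + K + 1) (chain s' i.succ) V *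
                dressedSlotsOfDatum₉ F N θ.toStage9Params (datumOfRecord₁₃CoPH F N θ hP) g₀ os t (runB₁₃ F K₀ g₀ K) (histB₁₃ θ K₀ g₀ K) (K₀ + K + 1) (chain s' i.succ) V) V) ∧
          (∀ s', kr K (keyB₁₃ θ K₀ g₀ K s') ∈ badClassK₁₃ θ K₀ g₀ kr bd K t → kr K (keyB₁₃ θ K₀ g₀ K (chain s' (Fin.last (n s')))) ∉ badClassK₁₃ θ K₀ g₀ kr bd K t) ∧
          (∀ σ s', kr K (keyB₁₃ θ K₀ g₀ K s') ∈ badClassK₁₃ θ K₀ g₀ kr bd K t → chain s' (Fin.last (n s')) = σ →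
            (∀ i, comp s' i ∈ Old σ) ∧ 0 < n s' ∧ Function.Injective (comp s')) ∧
          (∀ σ, Set.InjOn (fun s' => (Finset.univ : Finset (Fin (n s'))).image (comp s')) {s' | kr K (keyB₁₃ θ K₀ g₀ K s') ∈ badClassK₁₃ θ K₀ g₀ kr bd K t ∧ chain s' (Fin.last (n s')) = σ}) ∧
          (∀ σ, ∀ Y ∈ Old σ, (slot Y).1 < K₀ + jstar K + 1) ∧
          (∀ σ, ∀ Y ∈ Old σ, (slot Y).2 ∈ Fintype.piFinset fun _ : Fin 4 => Finset.range (2 * F.L ^ F.m * F.L ^ ((K₀ + K + 1) - (slot Y).1))) ∧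
          (∀ σ, ∀ Y ∈ Old σ, Consistent C₀ (K₀ + K + 1) (fun s => RkOfRecord F.L r (histB₁₃ θ K₀ g₀ K s)) (G Y)) ∧
          (∀ σ, ∀ Y ∈ Old σ, (G Y).WF (dictW (fun s => RkOfRecord F.L r (histB₁₃ θ K₀ g₀ K s)) C₀.n₁)) ∧
          (∀ σ, ∀ Y ∈ Old σ, K₀ + K + 1 < (G Y).reach (dictW (fun s => RkOfRecord F.L r (histB₁₃ θ K₀ g₀ K s)) C₀.n₁)) ∧ (∀ σ, ∀ Y ∈ Old σ, Chrono PEv.step (G Y)) ∧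
          (∀ σ, ∀ Y ∈ Old σ, ∀ e ∈ (G Y).events, e.kind = 0 → e.fat < Dcap (K₀ + K + 1)) ∧ (∀ σ, ∀ Y ∈ Old σ, fuel (G Y) ≤ Ncap (K₀ + K + 1)) ∧
          (∀ σ, ∀ Y ∈ Old σ, (G Y).rootStep = (slot Y).1) ∧
          (∀ σ, ∀ j < K₀ + jstar K + 1, ∀ zc ∈ (Fintype.piFinset fun _ : Fin 4 => Finset.range (2 * F.L ^ F.m * F.L ^ ((K₀ + K + 1) - j))),
            ∀ G₀ ∈ canonFam Dcap Ncap (K₀ + K + 1) j,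
            ((((Old σ).filter fun Y => slot Y = ⟨j, zc⟩ ∧ relabel shape (G Y) = G₀).card : ℕ) : ℝ) ≤ M ^ partnerAges PEv.step G₀)) →
      RelWeightBound 1 (classSetK₁₃ θ K₀ g₀ kr) (weightAK₁₃ θ hP K₀ g₀ os kr) (weightBK₁₃ θ hP K₀ g₀ os kr) (badClassK₁₃ θ K₀ g₀ kr bd)
        (fun K => 1 - Real.exp (-(birthMass C₀ * Real.exp (-κ₁) * (((2 * F.L ^ F.m : ℕ) : ℝ) ^ 4) *
          ((((F.L : ℝ) ^ 4) * Real.exp (ηplus - κ₁)) ^ (K - jstar K + 1) / (1 - ((F.L : ℝ) ^ 4) * Real.exp (ηplus - κ₁)))))) := by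
  obtain ⟨κ₁, E₀, γ₀, hκ, hE, hγ, hr, hx₀⟩ :=
    exists_margins_smallCoupling_relWeightBound_chronoGenealogies_ofRecord (F := F) (X := X) C₀ hCv ha hA hμ₀ hβ hrq hM hη
  refine ⟨κ₁, E₀, γ₀, hκ, hE, hγ, hr, ?_⟩
  intro N _ θ hP K₀ g₀ os kr bd c hc jstar hjK hfrac β' hβ' hβL hI h27 Dcap Ncap hmA hintA hmB hintB hbA hbB hLA hLB
  refine hx₀ θ hP K₀ g₀ os kr bd c hc jstar hjK hfrac β' hβ' hβL hI h27 Dcap Ncap hmA hintA hmB hintB ?_ ?_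
  · -- run A: the schedule's end is the removal map, the product of the scheduled raw factors the factor, the schedule's image the fibre family
    intro K t ht
    obtain ⟨n, chain, comp, fib, fibY, Old, slot, G, h0, hsub, hlink, hgood, hφ, hinj, hslot1, hslot2, hcons, hWF, hreach, hchr, hfat, hfuel, hroot, hID⟩ :=
      hLA K t ht
    choose CA hCA using hbA K t
    refine ⟨fun s => chain s (Fin.last (n s)), fib,
      fun s => ∏ i : Fin (n s), (Real.exp (-credits (T4PrintedShapeBanking.credit C₀ (fun j => histA₁₃ θ K₀ g₀ K (min j (K₀ + K)))) (G (comp s i))) *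
        Real.exp (lifeCost (dictW (fun s => RkOfRecord F.L r (histA₁₃ θ K₀ g₀ K s)) C₀.n₁)
          (T4PrintedShapeBanking.cost C₀ (K₀ + K) (fun s => RkOfRecord F.L r (histA₁₃ θ K₀ g₀ K s))) (G (comp s i)))),
      Old, fun _ s => (Finset.univ : Finset (Fin (n s))).image (comp s), slot, G, ?_, hgood, ?_, hinj, ?_, hslot1, hslot2, hcons, hWF, hreach, hchr, hfat,
      hfuel, hroot, hID⟩
    · intro s hs V
      have h := fibreDom_chain (fib s) (n s)
        (fun k => fun V => chiSeqOfRecord F N θ.ν θ.τ9.M (histA₁₃ θ K₀ g₀ K) (K₀ + K) (K₀ + K) (chain s k) V *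
          dressedSlotsOfDatum₉ F N θ.toStage9Params (datumOfRecord₁₃CoPH F N θ hP) g₀ os t (runA₁₃ F K₀ g₀ K) (histA₁₃ θ K₀ g₀ K) (K₀ + K) (chain s k) V)
        (fun i => fibY (comp s i)) (fun k => CA (chain s k))
        (fun i => Real.exp (-credits (T4PrintedShapeBanking.credit C₀ (fun j => histA₁₃ θ K₀ g₀ K (min j (K₀ + K)))) (G (comp s i))) *
          Real.exp (lifeCost (dictW (fun s => RkOfRecord F.L r (histA₁₃ θ K₀ g₀ K s)) C₀.n₁)
            (T4PrintedShapeBanking.cost C₀ (K₀ + K) (fun s => RkOfRecord F.L r (histA₁₃ θ K₀ g₀ K s))) (G (comp s i))))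
        (hsub s hs) (fun k => hmA K t _) (fun k W => hCA _ W) (fun i => by positivity) (hlink s hs) V
      rwa [h0 s hs] at h
    · intro σ s hs hrm
      refine ⟨fun Y hY => ?_, ⟨comp s ⟨0, (hφ σ s hs hrm).2.1⟩, Finset.mem_image_of_mem _ (Finset.mem_univ _)⟩⟩
      obtain ⟨i, _, rfl⟩ := Finset.mem_image.1 hY
      exact (hφ σ s hs hrm).1 i
    · intro σ s hs hrm
      beta_reduce
      rw [Finset.prod_image fun i _ k _ (h : comp s i = comp s k) => (hφ σ s hs hrm).2.2 h]
  · -- run B: the same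
    intro K t ht
    obtain ⟨n, chain, comp, fib, fibY, Old, slot, G, h0, hsub, hlink, hgood, hφ, hinj, hslot1, hslot2, hcons, hWF, hreach, hchr, hfat, hfuel, hroot, hID⟩ :=
      hLB K t ht
    choose CB hCB using hbB K t
    refine ⟨fun s' => chain s' (Fin.last (n s')), fib,
      fun s' => ∏ i : Fin (n s'), (Real.exp (-credits (T4PrintedShapeBanking.credit C₀ (fun j => histB₁₃ θ K₀ g₀ K (min j (K₀ + K + 1)))) (G (comp s' i))) *
        Real.exp (lifeCost (dictW (fun s => RkOfRecord F.L r (histB₁₃ θ K₀ g₀ K s)) C₀.n₁)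
          (T4PrintedShapeBanking.cost C₀ (K₀ + K + 1) (fun s => RkOfRecord F.L r (histB₁₃ θ K₀ g₀ K s))) (G (comp s' i)))),
      Old, fun _ s' => (Finset.univ : Finset (Fin (n s'))).image (comp s'), slot, G, ?_, hgood, ?_, hinj, ?_, hslot1, hslot2, hcons, hWF, hreach, hchr, hfat,
      hfuel, hroot, hID⟩
    · intro s' hs V
      have h := fibreDom_chain (fib s') (n s')
        (fun k => fun V => chiSeqOfRecord F N θ.ν θ.τ9.M (histB₁₃ θ K₀ g₀ K) (K₀ + K + 1) (K₀ + K + 1) (chain s' k) V *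
          dressedSlotsOfDatum₉ F N θ.toStage9Params (datumOfRecord₁₃CoPH F N θ hP) g₀ os t (runB₁₃ F K₀ g₀ K) (histB₁₃ θ K₀ g₀ K) (K₀ + K + 1) (chain s' k) V)
        (fun i => fibY (comp s' i)) (fun k => CB (chain s' k))
        (fun i => Real.exp (-credits (T4PrintedShapeBanking.credit C₀ (fun j => histB₁₃ θ K₀ g₀ K (min j (K₀ + K + 1)))) (G (comp s' i))) *
          Real.exp (lifeCost (dictW (fun s => RkOfRecord F.L r (histB₁₃ θ K₀ g₀ K s)) C₀.n₁)
            (T4PrintedShapeBanking.cost C₀ (K₀ + K + 1) (fun s => RkOfRecord F.L r (histB₁₃ θ K₀ g₀ K s))) (G (comp s' i))))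
        (hsub s' hs) (fun k => hmB K t _) (fun k W => hCB _ W) (fun i => by positivity) (hlink s' hs) V
      rwa [h0 s' hs] at h
    · intro σ s' hs hrm
      refine ⟨fun Y hY => ?_, ⟨comp s' ⟨0, (hφ σ s' hs hrm).2.1⟩, Finset.mem_image_of_mem _ (Finset.mem_univ _)⟩⟩
      obtain ⟨i, _, rfl⟩ := Finset.mem_image.1 hY
      exact (hφ σ s' hs hrm).1 i
    · intro σ s' hs hrm
      beta_reduce
      rw [Finset.prod_image fun i _ k _ (h : comp s' i = comp s' k) => (hφ σ s' hs hrm).2.2 h]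

end PerRegion

end YMDAG.UVSplit
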